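import Mathlib
import Summits.ValiantsHypothesis.ValiantsHypothesis.Theorems.NewtonUnitEquationsNewtonTauWeakCornerWords
import Summits.ValiantsHypothesis.ValiantsHypothesis.Theorems.NewtonUnitEquationsNewtonTauWeakK3Defs

/-!
# `NewtonTauWeak` (stmt-ValiantsHypothesis-5904), stub `fixedKCoincidence_t2_K3`: truncated division

Helper file of the proof of the `K = 3` sub-stub `fixedKCoincidence_t2_K3` of `stub_binomialNewtonTauCommon`
(line `binomial-normal-form`; siege variation "polynomial identity route").  The local corner lemmas
(`corner_rigidity` of lead c2, `shifted_corner_rigidity`) are stated for a corner combination already DIVIDED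
by one of the separated products.  Division by a univariate factor `Q` with `Q(0) = 1` is done here by
polynomials only: the truncated inverse `Σ_{i ≤ M} (1 - Q)^i` (so `Q · Σ = 1 - (1 - Q)^{M+1} ≡ 1 mod X^{M+1}`,
a polynomial identity), truncated quotients `R` of degree `≤ M` with `Q R ≡ P mod X^{M+1}`
(`exists_truncated_quotients`), and the transfer of ORDERS through such a congruence
(`isOrder_iff_of_mul_congr`: for `P(0) = Q(0) = 1`, `ord R = ord(P - Q)` below `M`).  Also: coefficientwise
low-weight congruences in `ℂ[ℤ²]` under scalars, sums and monomial shifts (the product rule is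
`NewtonTauWeakFixedK3k16.lowEq_prod`).  No definitions. [folklore]
-/

set_option linter.dupNamespace false

noncomputable section

open scoped BigOperators Polynomial

namespace Summit.ValiantsHypothesis.ValiantsHypothesis.Theorems.NewtonUnitEquationsNewtonTauWeak

open Summit.ValiantsHypothesis.ValiantsHypothesis.Theorems.NewtonTauWeakCorner
open Summit.ValiantsHypothesis.ValiantsHypothesis.Theorems.NewtonTauWeakK3

namespace K3Pi

/-! ## Low coefficients of products of univariate polynomials -/

/-- The coefficients of `Q R` below `M` only see the coefficients of `R` below `M`. [folklore] -/
theorem coeff_mul_congr_low (Q R R' : ℂ[X]) (M : ℕ) (h : ∀ j, j ≤ M → R.coeff j = R'.coeff j) :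
    ∀ j, j ≤ M → (Q * R).coeff j = (Q * R').coeff j := by
  intro j hj
  rw [Polynomial.coeff_mul, Polynomial.coeff_mul]
  refine Finset.sum_congr rfl fun x hx => ?_
  have hx2 : x.2 ≤ j := by have := Finset.HasAntidiagonal.mem_antidiagonal.mp hx; omega
  rw [h x.2 (hx2.trans hj)]

/-- A multiple of `X^{M+1}` has no coefficients below `M + 1`. [folklore] -/
theorem coeff_eq_zero_of_X_pow_dvd {F : ℂ[X]} {M : ℕ} (h : Polynomial.X ^ (M + 1) ∣ F) :
    ∀ j, j ≤ M → F.coeff j = 0 := fun j hj =>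
  (Polynomial.X_pow_dvd_iff.mp h) j (Nat.lt_succ_of_le hj)

/-- `(1 - Q)^{M+1}` is a multiple of `X^{M+1}` when `Q(0) = 1`. [folklore] -/
theorem X_pow_dvd_one_sub_pow (Q : ℂ[X]) (hQ0 : Q.coeff 0 = 1) (M : ℕ) :
    Polynomial.X ^ (M + 1) ∣ (1 - Q) ^ (M + 1) := by
  refine pow_dvd_pow_of_dvd ?_ (M + 1)
  rw [Polynomial.X_dvd_iff, Polynomial.coeff_sub, Polynomial.coeff_one_zero, hQ0, sub_self]

/-- **Truncated inverse and truncated quotients.** For `Q(0) = 1` and a precision `M` there is a polynomial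
`Tq` with `Tq(0) = 1` and `Q · Tq ≡ 1 mod X^{M+1}`, and every `P` has a truncated quotient `R` of degree `≤ M`
with `R ≡ P · Tq` and `Q · R ≡ P mod X^{M+1}`. [folklore] -/
theorem exists_truncated_quotients (Q : ℂ[X]) (hQ0 : Q.coeff 0 = 1) (M : ℕ) :
    ∃ Tq : ℂ[X], Tq.coeff 0 = 1 ∧ (∀ j, j ≤ M → (Q * Tq).coeff j = if j = 0 then 1 else 0) ∧
      ∀ P : ℂ[X], ∃ R : ℂ[X], R.natDegree ≤ M ∧ (∀ j, j ≤ M → R.coeff j = (P * Tq).coeff j) ∧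
        ∀ j, j ≤ M → (Q * R).coeff j = P.coeff j := by
  classical
  set Tq : ℂ[X] := ∑ i ∈ Finset.range (M + 1), (1 - Q) ^ i with hTq
  -- the geometric-sum identity `Q · Tq = 1 - (1 - Q)^{M+1}`
  have hgeom : Q * Tq = 1 - (1 - Q) ^ (M + 1) := by
    have h := mul_geom_sum (1 - Q) (M + 1)
    rw [show (1 - Q - 1 : ℂ[X]) = -Q by ring] at h
    rw [hTq]
    linear_combination -h
  have hQTq : ∀ j, j ≤ M → (Q * Tq).coeff j = if j = 0 then 1 else 0 := by
    intro j hj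
    rw [hgeom, Polynomial.coeff_sub, coeff_eq_zero_of_X_pow_dvd (X_pow_dvd_one_sub_pow Q hQ0 M) j hj, sub_zero,
      Polynomial.coeff_one]
  have hTq0 : Tq.coeff 0 = 1 := by
    have := hQTq 0 (Nat.zero_le M)
    rw [if_pos rfl, Polynomial.mul_coeff_zero, hQ0, one_mul] at this
    exact this
  refine ⟨Tq, hTq0, hQTq, fun P => ?_⟩
  -- the truncation of `P · Tq` below `M + 1`
  set R : ℂ[X] := ∑ k ∈ Finset.range (M + 1), Polynomial.monomial k ((P * Tq).coeff k) with hR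
  have hRcoeff : ∀ j, R.coeff j = if j ≤ M then (P * Tq).coeff j else 0 := by
    intro j
    rw [hR, Polynomial.finsetSum_coeff]
    simp only [Polynomial.coeff_monomial, Finset.sum_ite_eq', Finset.mem_range, Nat.lt_succ_iff]
  have hRdeg : R.natDegree ≤ M := by
    rw [Polynomial.natDegree_le_iff_coeff_eq_zero]
    intro j hj
    rw [hRcoeff, if_neg]
    exact fun h => absurd hj (not_lt.mpr (by exact_mod_cast h))
  have hRlow : ∀ j, j ≤ M → R.coeff j = (P * Tq).coeff j := fun j hj => by rw [hRcoeff, if_pos hj]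
  refine ⟨R, hRdeg, hRlow, fun j hj => ?_⟩
  -- `Q R ≡ Q (P Tq) = P (Q Tq) = P - P (1-Q)^{M+1} ≡ P`
  rw [coeff_mul_congr_low Q R (P * Tq) M hRlow j hj, mul_left_comm, hgeom, mul_sub, mul_one,
    Polynomial.coeff_sub, coeff_eq_zero_of_X_pow_dvd ((X_pow_dvd_one_sub_pow Q hQ0 M).mul_left P) j hj, sub_zero]

/-! ## Orders through a congruence `Q · R ≡ P mod X^{M+1}` -/

/-- Low coefficients of `P - Q` versus those of `R` when `Q R ≡ P`, `Q(0) = R(0) = 1`: if `R` has no coefficients in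
degrees `1 … k-1` then `[s^j](P - Q) = [s^j] R` for `1 ≤ j ≤ k ≤ M`. [folklore] -/
theorem coeff_sub_eq_of_mul_congr (P Q R : ℂ[X]) (M : ℕ) (hQ0 : Q.coeff 0 = 1) (hR0 : R.coeff 0 = 1)
    (hcongr : ∀ j, j ≤ M → (Q * R).coeff j = P.coeff j) (k : ℕ) (hkM : k ≤ M)
    (hvan : ∀ i, 1 ≤ i → i < k → R.coeff i = 0) : ∀ j, 1 ≤ j → j ≤ k → (P - Q).coeff j = R.coeff j := by
  intro j hj1 hjk
  have hjM : j ≤ M := hjk.trans hkM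
  rw [Polynomial.coeff_sub, ← hcongr j hjM, Polynomial.coeff_mul]
  -- split off the terms `(0, j)` and `(j, 0)` of the antidiagonal
  rw [Finset.Nat.sum_antidiagonal_eq_sum_range_succ (fun a b => Q.coeff a * R.coeff b) j,
    Finset.sum_range_succ, Finset.sum_eq_single_of_mem 0 (Finset.mem_range.mpr (by omega))]
  · simp only [Nat.sub_zero, Nat.sub_self, hQ0, hR0, one_mul, mul_one]
    ring
  · intro i hi hi0
    have hi' : i < j := Finset.mem_range.mp hi
    have : R.coeff (j - i) = 0 := hvan (j - i) (by omega) (by omega)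
    rw [this, mul_zero]

/-- **Order transfer.** If `Q R ≡ P mod X^{M+1}` with `P(0) = Q(0) = R(0) = 1`, then for `k ≤ M` the truncated
quotient `R` has order `k` at the corner iff `P - Q` has: `ord(P/Q) = ord(P - Q)`. [folklore] -/
theorem isOrder_iff_of_mul_congr (P Q R : ℂ[X]) (M : ℕ) (hQ0 : Q.coeff 0 = 1) (hR0 : R.coeff 0 = 1)
    (hcongr : ∀ j, j ≤ M → (Q * R).coeff j = P.coeff j) (k : ℕ) (hkM : k ≤ M) :
    IsOrder R k ↔ IsOrder (P - Q) k := by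
  constructor
  · rintro ⟨hk1, hk, hvan⟩
    have h := coeff_sub_eq_of_mul_congr P Q R M hQ0 hR0 hcongr k hkM hvan
    exact ⟨hk1, by rw [h k hk1 le_rfl]; exact hk, fun j hj hjk => by rw [h j hj hjk.le]; exact hvan j hj hjk⟩
  · rintro ⟨hk1, hk, hvan⟩
    -- the coefficients of `R` vanish in degrees `1 … k-1`, by strong induction
    have hRvan : ∀ i, 1 ≤ i → i < k → R.coeff i = 0 := by
      intro i
      induction i using Nat.strong_induction_on with
      | _ i ih =>
        intro hi1 hik
        have h := coeff_sub_eq_of_mul_congr P Q R M hQ0 hR0 hcongr i (by omega)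
          (fun i' hi'1 hi'i => ih i' hi'i hi'1 (by omega)) i hi1 le_rfl
        rw [← h]
        exact hvan i hi1 hik
    have h := coeff_sub_eq_of_mul_congr P Q R M hQ0 hR0 hcongr k hkM hRvan
    exact ⟨hk1, by rw [← h k hk1 le_rfl]; exact hk, hRvan⟩

/-- The order of an active difference `P - Q` (`P(0) = Q(0)`) is at most the larger degree. [folklore] -/
theorem IsOrder.le_max_natDegree {P Q : ℂ[X]} {k : ℕ} (h : IsOrder (P - Q) k) :
    k ≤ max P.natDegree Q.natDegree :=
  h.le_natDegree.trans (Polynomial.natDegree_sub_le P Q)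

/-! ## Low-weight congruences in the Laurent algebra: scalars, sums, shifts -/

/-- Low-weight congruence is preserved by scalars. [folklore] -/
theorem lowEq_smul {w : Fin 2 → ℝ} {β : ℝ} {F F' : Laurent} (c : ℂ)
    (h : ∀ z, wt w z < β → F.coeff z = F'.coeff z) : ∀ z, wt w z < β → (c • F).coeff z = (c • F').coeff z := by
  intro z hz
  rw [coeff_smul, coeff_smul, h z hz]

/-- Low-weight congruence is preserved by sums. [folklore] -/
theorem lowEq_add {w : Fin 2 → ℝ} {β : ℝ} {F F' G G' : Laurent}
    (hF : ∀ z, wt w z < β → F.coeff z = F'.coeff z) (hG : ∀ z, wt w z < β → G.coeff z = G'.coeff z) :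
    ∀ z, wt w z < β → (F + G).coeff z = (F' + G').coeff z := by
  intro z hz
  rw [AddMonoidAlgebra.coeff_add, AddMonoidAlgebra.coeff_add, Finsupp.add_apply, Finsupp.add_apply, hF z hz,
    hG z hz]

/-- Low-weight congruence is preserved by shifts of nonnegative weight. [folklore] -/
theorem lowEq_T_mul {w : Fin 2 → ℝ} {β : ℝ} {F F' : Laurent} (r : Fin 2 → ℤ) (hr : 0 ≤ wt w r)
    (h : ∀ z, wt w z < β → F.coeff z = F'.coeff z) :
    ∀ z, wt w z < β → (T r * F).coeff z = (T r * F').coeff z := by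
  intro z hz
  rw [coeff_T_mul, coeff_T_mul]
  refine h (z - r) ?_
  rw [wt_sub]; linarith

/-- Nonnegative-weight support of a shift by a monomial of nonnegative weight. [folklore] -/
theorem nonneg_T_mul {w : Fin 2 → ℝ} {F : Laurent} (r : Fin 2 → ℤ) (hr : 0 ≤ wt w r)
    (h : ∀ z, F.coeff z ≠ 0 → 0 ≤ wt w z) : ∀ z, (T r * F).coeff z ≠ 0 → 0 ≤ wt w z := by
  intro z hz
  rw [coeff_T_mul] at hz
  have := h _ hz
  rw [wt_sub] at this; linarith

/-- An upper weight bound for the support transfers along a bottom: the bottom weighs at most any bound valid on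
the support. [folklore] -/
theorem wt_le_of_isBot {w : Fin 2 → ℝ} {F : Laurent} {v : Fin 2 → ℤ} {Λ : ℝ} (hv : IsBot w F v)
    (hF : ∀ z, F.coeff z ≠ 0 → wt w z ≤ Λ) : wt w v ≤ Λ := hF v hv.1

/-- **Archimedean choice of the precision.** For `μ > 0` and any `Λ` there is `M ≥ D` with `Λ < (M+1) μ`.
[folklore] -/
theorem exists_precision (μ Λ : ℝ) (hμ : 0 < μ) (D : ℕ) : ∃ M : ℕ, D ≤ M ∧ Λ < ((M : ℝ) + 1) * μ := by
  obtain ⟨n, hn⟩ := exists_nat_gt (Λ / μ)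
  refine ⟨max n D, le_max_right _ _, ?_⟩
  have h1 : Λ < (n : ℝ) * μ := by rwa [div_lt_iff₀ hμ] at hn
  have h2 : (n : ℝ) * μ ≤ ((max n D : ℕ) + 1 : ℝ) * μ := by
    apply mul_le_mul_of_nonneg_right _ hμ.le
    have : (n : ℝ) ≤ ((max n D : ℕ) : ℝ) := by exact_mod_cast le_max_left n D
    linarith
  linarith

end K3Pi

end Summit.ValiantsHypothesis.ValiantsHypothesis.Theorems.NewtonUnitEquationsNewtonTauWeak

end
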